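import Literature.AlgebraicGeometry.Resolution.KawasakiBlowupInduction
import Literature.AlgebraicGeometry.Resolution.BlowupChartsFractionField
import HarnessLib

/-!
# The product charts of Kawasaki's blow-up are localizations of the recursive charts

Topic: `Literature/AlgebraicGeometry/Resolution`. The centre of Kawasaki's blow-up at level `p` is
the product ideal `I_p = ∏_{t=p}^{d-1} (x_{t+1},…,x_d)` (`kCentre xs p`); it is generated by the
product monomials `G_f = ∏_{t=p}^{d-1} x_{f(t)+1}` with `t ≤ f t < d` (`rawProd`,
`span_rawProd_eq_kCentre`), so `Bl_{I_p}` is covered by the charts `R[I_p/G_f]`. The induction of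
`KawasakiBlowupInduction.lean` only treats the RECURSIVE charts (`AdmChart`); this file attaches to
every product chart `f` a recursive one, `crec f` (`admChart_crec`), and shows inside the fraction
field of the domain `R` that

`G_f / G_{crec f} ∈ R[I/G_f]` (`div_rawProd_crec_mem_fracChart`),

so that `R[I/G_{crec f}] ⊆ R[I/G_f] = R[I/G_{crec f}][(G_f/G_{crec f})⁻¹]`
(`BlowupChartsFractionField.lean`): every local ring of `Bl_I(R)` is a local ring of a recursive
chart. This is the affine content of Česnavičius's remark that on the local ring `R'` of
`Bl_{I_{s-1}}(R)` the ideal `(r_1,…,r_s)R'` is `(r_a, r_s)R'` for a suitable `a`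
(Česnavičius 2021, proof of Thm. 3.13), iterated down the tower of blow-ups.

Everything is proved; no named facts.

## References

* [Cesnavicius2021] K. Česnavičius, *Macaulayfication of Noetherian schemes*, Duke Math. J. 170
  (2021), proof of Thm. 3.13.
* [Kawasaki2000] T. Kawasaki, *On Macaulayfication of Noetherian schemes*, Trans. AMS 352 (2000),
  proof of Thm. 4.1 (the charts `R[Q/x_{i_1}⋯x_{i_s}]`, (4.3.2)).
* [StacksProject] The Stacks Project, Tag 0804.
-/

noncomputable section

open IsLocalRing Ideal

namespace Literature.AlgebraicGeometry.Resolution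

universe u

variable {R : Type u} [CommRing R] {xs : List R}

/-! ## Product monomials -/

/-- A choice function `f` is **admissible** if `t ≤ f t < d` for `t < d`: `x_{f(t)+1}` is one of the
generators `x_{t+1},…,x_d` of the `t`-th factor of the centre. [cite: Kawasaki2000, Thm. 4.1 (proof)] -/
def Adm (xs : List R) (f : ℕ → ℕ) : Prop := ∀ t, t < xs.length → t ≤ f t ∧ f t < xs.length

/-- **The product monomial `G_f = ∏_{t=p}^{d-1} x_{f(t)+1}`** (level `p`).
[cite: Kawasaki2000, Thm. 4.1 (proof, the elements `x_{i_1}⋯x_{i_s}`)] -/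
def rawProd (xs : List R) (f : ℕ → ℕ) (p : ℕ) : R :=
  ∏ t ∈ Finset.Ico p xs.length, xs.getD (f t) 1

/-- `G_f(p) = x_{f(p)+1} G_f(p+1)`. [folklore] -/
theorem rawProd_succ {f : ℕ → ℕ} {p : ℕ} (hp : p < xs.length) :
    rawProd xs f p = xs.getD (f p) 1 * rawProd xs f (p + 1) :=
  Finset.prod_eq_prod_Ico_succ_bot hp _

/-- `G_f(d-1) = x_{f(d-1)+1}`. [folklore] -/
theorem rawProd_length_sub_one {f : ℕ → ℕ} (h : 0 < xs.length) :
    rawProd xs f (xs.length - 1) = xs.getD (f (xs.length - 1)) 1 := by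
  rw [rawProd]
  conv_lhs => rw [show xs.length = xs.length - 1 + 1 by omega]
  rw [Nat.add_sub_cancel, Nat.Ico_succ_singleton, Finset.prod_singleton]

/-- `I_p = ∏_{t ∈ [p, d)} (x_{t+1},…,x_d)`. [folklore] -/
theorem kCentre_eq_prod_Ico {p : ℕ} (hp : p < xs.length) :
    kCentre xs p = ∏ t ∈ Finset.Ico p xs.length, tailIdeal xs t := by
  induction hn : xs.length - 1 - p generalizing p with
  | zero =>
    obtain rfl : p = xs.length - 1 := by omega
    rw [kCentre_length_sub_one]
    conv_rhs => rw [show xs.length = xs.length - 1 + 1 by omega]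
    rw [Nat.add_sub_cancel, Nat.Ico_succ_singleton, Finset.prod_singleton]
  | succ n ih =>
    rw [kCentre_eq_mul (by omega), ih (by omega) (by omega),
      Finset.prod_eq_prod_Ico_succ_bot hp, mul_comm]

/-- `x_{f(t)+1} ∈ (x_{t+1},…,x_d)` for admissible `f`. [folklore] -/
theorem getD_mem_tailIdeal {f : ℕ → ℕ} (hf : Adm xs f) {t : ℕ} (ht : t < xs.length) :
    xs.getD (f t) 1 ∈ tailIdeal xs t := by
  rw [getD_eq_getElem (hf t ht).2]
  exact getElem_mem_tailIdeal (hf t ht).1 _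

/-- `G_f ∈ I_p`. [cite: Kawasaki2000, Thm. 4.1 (proof)] -/
theorem rawProd_mem_kCentre {f : ℕ → ℕ} (hf : Adm xs f) {p : ℕ} (hp : p < xs.length) :
    rawProd xs f p ∈ kCentre xs p := by
  rw [kCentre_eq_prod_Ico hp, rawProd]
  exact Ideal.prod_mem_prod fun t ht => getD_mem_tailIdeal hf (Finset.mem_Ico.mp ht).2

/-- `xs.getD i 1 ≠ 0` when no parameter vanishes. [folklore] -/
theorem getD_ne_zero [Nontrivial R] (hx0 : ∀ x ∈ xs, x ≠ 0) (i : ℕ) : xs.getD i 1 ≠ 0 := by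
  by_cases hi : i < xs.length
  · rw [getD_eq_getElem hi]; exact hx0 _ (List.getElem_mem hi)
  · rw [List.getD_eq_getElem?_getD, List.getElem?_eq_none (not_lt.mp hi), Option.getD_none]
    exact one_ne_zero

/-- `G_f ≠ 0` in a domain none of whose parameters vanishes. [folklore] -/
theorem rawProd_ne_zero [IsDomain R] (hx0 : ∀ x ∈ xs, x ≠ 0) (f : ℕ → ℕ) (p : ℕ) :
    rawProd xs f p ≠ 0 :=
  Finset.prod_ne_zero_iff.mpr fun _ _ => getD_ne_zero hx0 _

/-- **`z ∏_{t' ≠ t} x_{f(t')+1} ∈ I_0` for `z ∈ (x_{t+1},…,x_d)`**: replacing one factor of a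
product monomial by any element of the corresponding factor ideal stays in the centre.
[cite: Kawasaki2000, Thm. 4.1 (proof)] -/
theorem mul_prod_erase_mem_kCentre {f : ℕ → ℕ} (hf : Adm xs f) {t : ℕ} (ht : t < xs.length)
    {z : R} (hz : z ∈ tailIdeal xs t) :
    z * ∏ t' ∈ (Finset.Ico 0 xs.length).erase t, xs.getD (f t') 1 ∈ kCentre xs 0 := by
  classical
  have htm : t ∈ Finset.Ico 0 xs.length := Finset.mem_Ico.mpr ⟨Nat.zero_le _, ht⟩
  set g : ℕ → R := fun t' => if t' = t then z else xs.getD (f t') 1 with hg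
  have h1 : z * ∏ t' ∈ (Finset.Ico 0 xs.length).erase t, xs.getD (f t') 1 =
      ∏ t' ∈ Finset.Ico 0 xs.length, g t' := by
    rw [← Finset.mul_prod_erase _ g htm, hg]
    simp only [if_true]
    congr 1
    exact Finset.prod_congr rfl fun t' ht' => by rw [if_neg (Finset.ne_of_mem_erase ht')]
  rw [h1, kCentre_eq_prod_Ico (by omega)]
  refine Ideal.prod_mem_prod fun t' ht' => ?_
  simp only [hg]
  split_ifs with h
  · subst h; exact hz
  · exact getD_mem_tailIdeal hf (Finset.mem_Ico.mp ht').2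

/-! ## The span of the product monomials -/

/-- **The product monomials generate the centre**: `I_p = (G_f : f admissible)`.
[cite: Kawasaki2000, Thm. 4.1 (proof)] -/
theorem span_rawProd_eq_kCentre {p : ℕ} (hp : p < xs.length) :
    Ideal.span {G | ∃ f, Adm xs f ∧ G = rawProd xs f p} = kCentre xs p := by
  apply le_antisymm
  · rw [Ideal.span_le]
    rintro _ ⟨f, hf, rfl⟩
    exact rawProd_mem_kCentre hf hp
  · induction hn : xs.length - 1 - p generalizing p with
    | zero =>
      obtain rfl : p = xs.length - 1 := by omega
      rw [kCentre_length_sub_one, tailIdeal, Ideal.span_le]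
      intro z hz
      obtain ⟨i, hi, rfl⟩ := List.mem_iff_getElem.mp hz
      rw [List.length_drop] at hi
      refine Ideal.subset_span ⟨fun _ => xs.length - 1, fun t ht =>
        ⟨(Nat.le_sub_one_of_lt ht : t ≤ xs.length - 1), Nat.sub_one_lt_of_lt ht⟩, ?_⟩
      rw [rawProd_length_sub_one (by omega), getD_eq_getElem (by omega), List.getElem_drop]
      congr 1; omega
    | succ n ih =>
      rw [kCentre_eq_mul (by omega : p + 1 < xs.length), Ideal.mul_le]
      intro a ha z hz
      have ha' := ih (by omega) (by omega) ha
      -- `z ∈ (x_{p+1},…,x_d)`: reduce to a generator `x_i`, `p ≤ i < d`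
      rw [tailIdeal] at hz
      refine Submodule.span_induction (p := fun z _ => a * z ∈ Ideal.span
          {G | ∃ f, Adm xs f ∧ G = rawProd xs f p}) ?_ ?_ ?_ ?_ hz
      · intro x hx
        obtain ⟨i, hi, rfl⟩ := List.mem_iff_getElem.mp hx
        rw [List.length_drop] at hi
        rw [List.getElem_drop]
        -- `a ∈ (G_f at level p+1)`: reduce to a generator
        refine Submodule.span_induction (p := fun a _ => a * xs[p + i] ∈ Ideal.span
            {G | ∃ f, Adm xs f ∧ G = rawProd xs f p}) ?_ ?_ ?_ ?_ ha'
        · rintro _ ⟨f, hf, rfl⟩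
          refine Ideal.subset_span ⟨Function.update f p (p + i), fun t ht => ?_, ?_⟩
          · rcases eq_or_ne t p with rfl | htp
            · rw [Function.update_self]; omega
            · rw [Function.update_of_ne htp]; exact hf t ht
          · rw [rawProd_succ (f := Function.update f p (p + i)) hp, Function.update_self,
              getD_eq_getElem (by omega), mul_comm (rawProd xs f (p + 1))]
            congr 1
            exact Finset.prod_congr rfl fun t ht => by
              rw [Function.update_of_ne (by have := (Finset.mem_Ico.mp ht).1; omega)]
        · rw [zero_mul]; exact Submodule.zero_mem _
        · intro a b _ _ ha hb; rw [add_mul]; exact Submodule.add_mem _ ha hb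
        · intro r a _ ha; rw [smul_eq_mul, mul_assoc]; exact Ideal.mul_mem_left _ r ha
      · rw [mul_zero]; exact Submodule.zero_mem _
      · intro x y _ _ hx hy; rw [mul_add]; exact Submodule.add_mem _ hx hy
      · intro r x _ hx; rw [smul_eq_mul, mul_left_comm]; exact Ideal.mul_mem_left _ r hx

/-! ## The recursive chart attached to a product chart -/

/-- **The recursive choice function `crec f`**: going down from `t = d - 1`, keep the new
parameter when `f` does (`f t = t`), otherwise keep the previous last factor.
[cite: Cesnavicius2021, proof of Thm. 3.13] -/
def crec (d : ℕ) (f : ℕ → ℕ) : ℕ → ℕ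
  | t => if _ : d ≤ t + 1 then d - 1 else if f t = t then t else crec d f (t + 1)
  termination_by t => d - t
  decreasing_by omega

/-- Top level: `crec f (d-1) = d-1`. [folklore] -/
theorem crec_of_le {d : ℕ} {f : ℕ → ℕ} {t : ℕ} (h : d ≤ t + 1) : crec d f t = d - 1 := by
  rw [crec, dif_pos h]

/-- New parameter kept. [folklore] -/
theorem crec_of_eq {d : ℕ} {f : ℕ → ℕ} {t : ℕ} (h : t + 1 < d) (hft : f t = t) :
    crec d f t = t := by
  rw [crec, dif_neg (by omega), if_pos hft]

/-- Old factor kept. [folklore] -/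
theorem crec_of_ne {d : ℕ} {f : ℕ → ℕ} {t : ℕ} (h : t + 1 < d) (hft : f t ≠ t) :
    crec d f t = crec d f (t + 1) := by
  rw [crec, dif_neg (by omega), if_neg hft]

omit [CommRing R] in
/-- `crec f` is admissible (indeed `t ≤ crec f t < d` for all `t < d`). [folklore] -/
theorem crec_adm (f : ℕ → ℕ) : Adm xs (crec xs.length f) := by
  intro t ht
  induction hn : xs.length - 1 - t generalizing t with
  | zero => rw [crec_of_le (by omega)]; omega
  | succ n ih =>
    by_cases hft : f t = t
    · rw [crec_of_eq (by omega) hft]; omega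
    · rw [crec_of_ne (by omega) hft]
      have := ih (t := t + 1) (by omega) (by omega)
      omega

/-- **`crec f` is a recursive chart**: `(G_{crec f}, x_{crec f (p) + 1})` is an `AdmChart` at
every level `p < d`. [cite: Cesnavicius2021, proof of Thm. 3.13] -/
theorem admChart_crec (f : ℕ → ℕ) {p : ℕ} (hp : p < xs.length) :
    AdmChart xs p (rawProd xs (crec xs.length f) p) (xs.getD (crec xs.length f p) 1) := by
  induction hn : xs.length - 1 - p generalizing p with
  | zero =>
    obtain rfl : p = xs.length - 1 := by omega
    rw [rawProd_length_sub_one (by omega), crec_of_le (by omega), getD_eq_getElem (by omega)]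
    exact AdmChart.base (by omega)
  | succ n ih =>
    have ih' := ih (p := p + 1) (by omega) (by omega)
    rw [rawProd_succ hp, mul_comm]
    by_cases hft : f p = p
    · rw [crec_of_eq (by omega) hft, getD_eq_getElem hp]
      exact AdmChart.new ih' hp
    · rw [crec_of_ne (by omega) hft]
      exact AdmChart.old ih' hp

/-! ## `G_f / G_{crec f} ∈ R[I/G_f]` -/

section Frac

variable [IsDomain R]

/-- **`(x_{t+1},…,x_d) R[I/G_f] = x_{f(t)+1} R[I/G_f]`**: for `z ∈ (x_{t+1},…,x_d)`,
`z / x_{f(t)+1} = z Ĝ_t / G_f ∈ R[I/G_f]` (`Ĝ_t` the product of the other factors).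
[cite: Kawasaki2000, Thm. 4.1 (proof)] [cite: StacksProject, Tag 0804] -/
theorem div_getD_mem_fracChart (hx0 : ∀ x ∈ xs, x ≠ 0) {f : ℕ → ℕ} (hf : Adm xs f) {t : ℕ}
    (ht : t < xs.length) {z : R} (hz : z ∈ tailIdeal xs t) :
    algebraMap R (FractionRing R) z / algebraMap R (FractionRing R) (xs.getD (f t) 1) ∈
      fracChart (kCentre xs 0) (rawProd xs f 0) := by
  classical
  have htm : t ∈ Finset.Ico 0 xs.length := Finset.mem_Ico.mpr ⟨Nat.zero_le _, ht⟩
  set E := ∏ t' ∈ (Finset.Ico 0 xs.length).erase t, xs.getD (f t') 1 with hE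
  have hE0 : algebraMap R (FractionRing R) E ≠ 0 :=
    (map_ne_zero_iff _ (IsFractionRing.injective R (FractionRing R))).mpr
      (Finset.prod_ne_zero_iff.mpr fun t' _ => getD_ne_zero hx0 _)
  have hprod : rawProd xs f 0 = xs.getD (f t) 1 * E :=
    (Finset.mul_prod_erase (Finset.Ico 0 xs.length) (fun t' => xs.getD (f t') 1) htm).symm
  have : algebraMap R (FractionRing R) z / algebraMap R (FractionRing R) (xs.getD (f t) 1) =
      algebraMap R (FractionRing R) (z * E) / algebraMap R (FractionRing R) (rawProd xs f 0) := by
    rw [hprod, map_mul, map_mul, mul_div_mul_right _ _ hE0]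
  rw [this]
  exact div_mem_fracChart _ (mul_prod_erase_mem_kCentre hf ht hz)

/-- **`x_{f(t)+1} / x_{crec f (t)+1} ∈ R[I/G_f]`** for all `t < d`: both generate
`(x_{t+1},…,x_d) R[I/G_f]`. Downward induction on `t`. [cite: Cesnavicius2021, proof of Thm. 3.13]
[cite: StacksProject, Tag 0804] -/
theorem div_getD_crec_mem_fracChart (hx0 : ∀ x ∈ xs, x ≠ 0) {f : ℕ → ℕ} (hf : Adm xs f) {t : ℕ}
    (ht : t < xs.length) :
    algebraMap R (FractionRing R) (xs.getD (f t) 1) /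
        algebraMap R (FractionRing R) (xs.getD (crec xs.length f t) 1) ∈
      fracChart (kCentre xs 0) (rawProd xs f 0) := by
  have hne : ∀ i, algebraMap R (FractionRing R) (xs.getD i 1) ≠ 0 := fun i =>
    (map_ne_zero_iff _ (IsFractionRing.injective R (FractionRing R))).mpr (getD_ne_zero hx0 i)
  induction hn : xs.length - 1 - t generalizing t with
  | zero =>
    have hft : f t = xs.length - 1 := by have := hf t ht; omega
    rw [crec_of_le (by omega), hft, div_self (hne _)]
    exact Subalgebra.one_mem _
  | succ n ih =>
    by_cases hft : f t = t
    · rw [crec_of_eq (by omega) hft, hft, div_self (hne _)]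
      exact Subalgebra.one_mem _
    · rw [crec_of_ne (by omega) hft, ← div_mul_div_cancel₀ (hne (f (t + 1)))]
      refine mul_mem ?_ (ih (t := t + 1) (by omega) (by omega))
      -- `x_{f t} ∈ (x_{t+2},…)` as `f t ≥ t + 1`
      refine div_getD_mem_fracChart hx0 hf (by omega) ?_
      rw [getD_eq_getElem (hf t ht).2]
      exact getElem_mem_tailIdeal (by have := (hf t ht).1; omega) _

/-- **`G_f / G_{crec f} ∈ R[I/G_f]`**: the recursive chart `D₊(G_{crec f} t)` contains the
product chart `D₊(G_f t)`. [cite: Cesnavicius2021, proof of Thm. 3.13] [cite: StacksProject, Tag 0804] -/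
theorem div_rawProd_crec_mem_fracChart (hx0 : ∀ x ∈ xs, x ≠ 0) {f : ℕ → ℕ} (hf : Adm xs f) :
    algebraMap R (FractionRing R) (rawProd xs f 0) /
        algebraMap R (FractionRing R) (rawProd xs (crec xs.length f) 0) ∈
      fracChart (kCentre xs 0) (rawProd xs f 0) := by
  rw [rawProd, rawProd, map_prod, map_prod, ← Finset.prod_div_distrib]
  exact Subalgebra.prod_mem _ fun t ht => div_getD_crec_mem_fracChart hx0 hf (Finset.mem_Ico.mp ht).2

/-- **`R[I/G_{crec f}] ⊆ R[I/G_f]`** inside `Frac R`. [cite: StacksProject, Tag 0804] -/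
theorem fracChart_crec_le (hx0 : ∀ x ∈ xs, x ≠ 0) {f : ℕ → ℕ} (hf : Adm xs f) :
    fracChart (kCentre xs 0) (rawProd xs (crec xs.length f) 0) ≤
      fracChart (kCentre xs 0) (rawProd xs f 0) :=
  fracChart_le_of_div_mem (rawProd_ne_zero hx0 f 0) (div_rawProd_crec_mem_fracChart hx0 hf)

end Frac

end Literature.AlgebraicGeometry.Resolution

end
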